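import Mathlib
import Literature.MathematicalPhysics.QuantumLattice.HubbardBandSectorCountingToolbox
import HarnessLib

/-!
# Four-sector counting, fold ranges: ALIGNED RIGIDITY — an aligned near-critical near-zero diagonal configuration is the FORWARD point

Topic `Literature/MathematicalPhysics/QuantumLattice`; sub-namespace `BandSectorCounting` (continues `HubbardBandSectorCountingToolbox`).
Part (F3d) of the log-free ANISOTROPIC anchored four-sector counting lemma («E1-P2-THIN-COUNT», cell gate-hubbard-kl, plan g17 (R41); seat p4; plan
HOME/prover-p4/E1-P2-THIN-COUNT-PLAN.md §Refinement 4).  On the diagonal `σ ↦ (θ₁; σ, σ)` of the four-leg count the momentum sum is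
`S₀(σ) = p(θ₁) + 2p(σ)`.  If the diagonal value is small (`|D(σ)| = |h(θ₁;σ,σ)| ≤ η₀`: `S₀` is near the Fermi curve modulo `2πℤ²`), the diagonal slope
is small (`|sin S_x·x′(σ) + sin S_y·y′(σ)| ≤ η₁`: the curve normal at `S₀` is parallel to the normal at `p(σ)`), and the configuration is ALIGNED
(`sin S_x·sin x(σ) + sin S_y·sin y(σ) > 0`: parallel, not anti-parallel — the forward type of `ThinSectorFoldSignedKey`), then `S₀ ≡ p(σ)` coordinate-wise
modulo `2π` up to `O(η₀ + η₁)`, hence `p(θ₁) + p(σ) ∈ 2πℤ² + O(η₀ + η₁)`; since every coordinate of the curve is `≤ K(μ) < π` in modulus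
(`umklappRadius`, BGM 2006 Remark after (2.39)) the lattice vector is `0`, so `p(σ) = −p(θ₁) + O(·) = p(θ₁ + π) + O(·)` and by the chord bound
`σ ≡ θ₁ + π (mod 2π)` up to `O(η₀ + η₁)`:

* **`abs_alignment_ge`** — the dichotomy: `|h(θ₁;σ,σ)| ≤ η₀`, `|sin S_x·x′(σ) + sin S_y·y′(σ)| ≤ η₁` ⇒ `ρ_min² − 2e₃ ≤ |sin S_x·sin x(σ) + sin S_y·sin y(σ)|`;
* **`aligned_rigidity`** — `|sin((σ − θ₁ − π)/2)| ≤ π·e₃/(√2·u_min)`, `e₃ = η₀/Dt_min + s_max·C_g·(η₁ + 2 s_max η₀/Dt_min)`, under `2e₃ < ρ_min²`, `e₃ < 1/2` and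
  the umklapp margin `π·e₃ + 2K(μ) < 2π`.

(The anti-aligned near-critical near-zero configurations are the umklapp CORNERS `p(θ₁) + 3p(σ) ∈ 2πℤ² ∖ {0}`; they are not located here — the count kills
their rows analytically, `row_kill_anti`.)  Everything is PROVED; no definitions, no named facts.

## Sources

* G. Benfatto, A. Giuliani, V. Mastropietro, Ann. Henri Poincaré 7 (2006) 809–898, Lemma 3.1, App. A2; Remark after (2.39). [BenfattoGiulianiMastropietro2006]
* V. Mastropietro, *Non-Perturbative Renormalization* (World Scientific, 2008), ch. 14, (14.67) p. 223. [Mastropietro2008]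
-/

noncomputable section

open Real Set
open Literature.MathematicalPhysics.QuantumLattice

namespace Literature.MathematicalPhysics.QuantumLattice.BandSectorCounting

/-- From `sin` and `cos` both close, the angles agree modulo `2π`: if `|sin A − sin B| ≤ e`, `|cos A − cos B| ≤ e`, `e < 1/2`, then
`A − B = 2πm + d` with `|d| ≤ π·e`. [folklore] -/
private theorem exists_int_near_of_sin_cos_close {A B e : ℝ} (hs : |Real.sin A - Real.sin B| ≤ e) (hc : |Real.cos A - Real.cos B| ≤ e)
    (he : e < 1 / 2) : ∃ m : ℤ, |A - B - m * (2 * π)| ≤ π * e := by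
  have hπ := Real.pi_pos
  have he0 : 0 ≤ e := (abs_nonneg _).trans hs
  obtain ⟨m, hm⟩ := exists_int_abs_sub_le_pi (A - B)
  set d := A - B - m * (2 * π) with hd
  refine ⟨m, ?_⟩
  -- `sin d = sin(A − B)`, `cos d = cos(A − B)`
  have hsd : Real.sin d = Real.sin A * Real.cos B - Real.cos A * Real.sin B := by
    rw [hd, Real.sin_sub_int_mul_two_pi, Real.sin_sub]
  have hcd : Real.cos d = Real.cos A * Real.cos B + Real.sin A * Real.sin B := by
    rw [hd, Real.cos_sub_int_mul_two_pi, Real.cos_sub]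
  -- `|sin d| ≤ 2e`, `cos d ≥ 1 − 2e > 0`
  have hB := Real.sin_sq_add_cos_sq B
  have hsin : |Real.sin d| ≤ 2 * e := by
    have e1 : Real.sin d = (Real.sin A - Real.sin B) * Real.cos B - (Real.cos A - Real.cos B) * Real.sin B := by rw [hsd]; ring
    rw [e1]
    have b1 : |(Real.sin A - Real.sin B) * Real.cos B| ≤ e * 1 := by
      rw [abs_mul]; exact mul_le_mul hs (Real.abs_cos_le_one _) (abs_nonneg _) he0
    have b2 : |(Real.cos A - Real.cos B) * Real.sin B| ≤ e * 1 := by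
      rw [abs_mul]; exact mul_le_mul hc (Real.abs_sin_le_one _) (abs_nonneg _) he0
    have := abs_sub ((Real.sin A - Real.sin B) * Real.cos B) ((Real.cos A - Real.cos B) * Real.sin B)
    linarith
  have hcos : 0 < Real.cos d := by
    have e1 : Real.cos d = 1 + ((Real.cos A - Real.cos B) * Real.cos B + (Real.sin A - Real.sin B) * Real.sin B) := by
      rw [hcd]; nlinarith [hB]
    have b1 : |(Real.cos A - Real.cos B) * Real.cos B| ≤ e * 1 := by
      rw [abs_mul]; exact mul_le_mul hc (Real.abs_cos_le_one _) (abs_nonneg _) he0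
    have b2 : |(Real.sin A - Real.sin B) * Real.sin B| ≤ e * 1 := by
      rw [abs_mul]; exact mul_le_mul hs (Real.abs_sin_le_one _) (abs_nonneg _) he0
    have := neg_abs_le ((Real.cos A - Real.cos B) * Real.cos B)
    have := neg_abs_le ((Real.sin A - Real.sin B) * Real.sin B)
    rw [e1]; linarith
  rcases near_zero_or_pi_of_abs_sin_le hm hsin with h | h
  · linarith
  · -- `π − |d| ≤ πe < π/2` contradicts `cos d > 0`
    exfalso
    have hlt : π - |d| < π / 2 := by nlinarith
    have h0 : 0 ≤ π - |d| := by linarith [hm]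
    have hcpos : 0 < Real.cos (π - |d|) := Real.cos_pos_of_mem_Ioo ⟨by linarith, hlt⟩
    rw [Real.cos_pi_sub, Real.cos_abs] at hcpos
    linarith

section Aligned

variable {a b : ℝ} (B : BandBounds a b) {μ : ℝ} (hμ : μ ∈ Icc a b)
include B hμ

/-- **Aligned rigidity.**  If the diagonal configuration `(θ₁; σ, σ)` has small level `|h(θ₁;σ,σ)| ≤ η₀`, small diagonal slope
`|sin S_x·x′(σ) + sin S_y·y′(σ)| ≤ η₁` and is ALIGNED, `0 < ι ≤ sin S_x·sin x(σ) + sin S_y·sin y(σ)` (`S = S₀(σ)`), then — with `e₃ = η₀/Dt_min +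
s_max·C_g(η₁ + 2s_max η₀/Dt_min)`, provided `2e₃ < ρ_min²`, `e₃ < 1/2` and the umklapp margin `π e₃ + 2K(μ) < 2π` — `σ` is the forward point up to
`O(e₃)`: `|sin((σ − θ₁ − π)/2)| ≤ π·e₃/(√2·u_min)`. [cite: BenfattoGiulianiMastropietro2006, App. A2] -/
theorem aligned_rigidity {θ₁ σ η₀ η₁ ι : ℝ} (hlo : a ≤ μ - η₀) (hhi : μ + η₀ ≤ b)
    (hH : |hfun μ θ₁ σ σ| ≤ η₀)
    (hH' : |Real.sin (SX μ θ₁ σ σ) * bandVX μ σ + Real.sin (SY μ θ₁ σ σ) * bandVY μ σ| ≤ η₁)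
    (hι : 0 < ι) (hI : ι ≤ Real.sin (SX μ θ₁ σ σ) * Real.sin (bandX μ σ) + Real.sin (SY μ θ₁ σ σ) * Real.sin (bandY μ σ))
    (hρ : 2 * (η₀ / B.Dtmin + B.smax * (B.Cg * (η₁ + 2 * B.smax * (η₀ / B.Dtmin)))) < B.rhomin ^ 2)
    (hhalf : η₀ / B.Dtmin + B.smax * (B.Cg * (η₁ + 2 * B.smax * (η₀ / B.Dtmin))) < 1 / 2)
    (hmargin : π * (η₀ / B.Dtmin + B.smax * (B.Cg * (η₁ + 2 * B.smax * (η₀ / B.Dtmin)))) + 2 * umklappRadius μ < 2 * π) :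
    |Real.sin ((σ - θ₁ - π) / 2)| ≤
      π * (η₀ / B.Dtmin + B.smax * (B.Cg * (η₁ + 2 * B.smax * (η₀ / B.Dtmin)))) / (Real.sqrt 2 * B.umin) := by
  obtain ⟨h1, h2⟩ := B.level hμ
  have hsm := B.smax_pos; have hCg := B.Cg_pos; have hD := B.Dtmin_pos; have hu := B.umin_pos
  have hπ := Real.pi_pos
  set Sx := SX μ θ₁ σ σ with hSx
  set Sy := SY μ θ₁ σ σ with hSy
  set e₃ := η₀ / B.Dtmin + B.smax * (B.Cg * (η₁ + 2 * B.smax * (η₀ / B.Dtmin))) with he₃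
  -- step 1: a curve point with the trigonometric data of `S`
  have hh' : |eps2 Sx Sy - μ| ≤ η₀ := by unfold hfun at hH; exact hH
  obtain ⟨φ, hsx, hsy, hcx, hcy⟩ := exists_near_curve_trig B hμ hh' hlo hhi
  have hη₀ : 0 ≤ η₀ := (abs_nonneg _).trans hH
  -- step 2: the normal at `φ` is parallel to the normal at `σ`: `φ ≡ σ (mod π)`
  have k1 : |Real.sin (bandX μ φ) * bandVX μ σ + Real.sin (bandY μ φ) * bandVY μ σ| ≤ η₁ + 2 * B.smax * (η₀ / B.Dtmin) :=
    (cross_perturb B hμ hsx hsy).trans (by linarith)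
  obtain ⟨j, hj⟩ := exists_int_near_of_cross_small B hμ k1
  -- step 3: sign alignment at `σ`
  obtain ⟨s, hs, ax, ay, cx, cy⟩ := exists_sign_align B hμ hj
  have hsabs : |s| = 1 := by rcases hs with rfl | rfl <;> norm_num
  -- `|s·sin Sx − sin xσ| ≤ e₃` etc.
  have dX : |s * Real.sin Sx - Real.sin (bandX μ σ)| ≤ e₃ := by
    calc |s * Real.sin Sx - Real.sin (bandX μ σ)|
        = |s * (Real.sin Sx - Real.sin (bandX μ φ)) + (s * Real.sin (bandX μ φ) - Real.sin (bandX μ σ))| := by ring_nf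
      _ ≤ |s * (Real.sin Sx - Real.sin (bandX μ φ))| + |s * Real.sin (bandX μ φ) - Real.sin (bandX μ σ)| := abs_add_le _ _
      _ ≤ η₀ / B.Dtmin + B.smax * (B.Cg * (η₁ + 2 * B.smax * (η₀ / B.Dtmin))) := by
          rw [abs_mul, hsabs, one_mul]; exact add_le_add hsx ax
  have dY : |s * Real.sin Sy - Real.sin (bandY μ σ)| ≤ e₃ := by
    calc |s * Real.sin Sy - Real.sin (bandY μ σ)|
        = |s * (Real.sin Sy - Real.sin (bandY μ φ)) + (s * Real.sin (bandY μ φ) - Real.sin (bandY μ σ))| := by ring_nf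
      _ ≤ |s * (Real.sin Sy - Real.sin (bandY μ φ))| + |s * Real.sin (bandY μ φ) - Real.sin (bandY μ σ)| := abs_add_le _ _
      _ ≤ η₀ / B.Dtmin + B.smax * (B.Cg * (η₁ + 2 * B.smax * (η₀ / B.Dtmin))) := by
          rw [abs_mul, hsabs, one_mul]; exact add_le_add hsy ay
  have cX : |Real.cos Sx - Real.cos (bandX μ σ)| ≤ e₃ := by
    calc |Real.cos Sx - Real.cos (bandX μ σ)| = |(Real.cos Sx - Real.cos (bandX μ φ)) + (Real.cos (bandX μ φ) - Real.cos (bandX μ σ))| := by ring_nf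
      _ ≤ |Real.cos Sx - Real.cos (bandX μ φ)| + |Real.cos (bandX μ φ) - Real.cos (bandX μ σ)| := abs_add_le _ _
      _ ≤ η₀ / B.Dtmin + B.smax * (B.Cg * (η₁ + 2 * B.smax * (η₀ / B.Dtmin))) := add_le_add hcx cx
  have cY : |Real.cos Sy - Real.cos (bandY μ σ)| ≤ e₃ := by
    calc |Real.cos Sy - Real.cos (bandY μ σ)| = |(Real.cos Sy - Real.cos (bandY μ φ)) + (Real.cos (bandY μ φ) - Real.cos (bandY μ σ))| := by ring_nf
      _ ≤ |Real.cos Sy - Real.cos (bandY μ φ)| + |Real.cos (bandY μ φ) - Real.cos (bandY μ σ)| := abs_add_le _ _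
      _ ≤ η₀ / B.Dtmin + B.smax * (B.Cg * (η₁ + 2 * B.smax * (η₀ / B.Dtmin))) := add_le_add hcy cy
  have he₃0 : 0 ≤ e₃ := (abs_nonneg _).trans dX
  -- step 4: the alignment forces `s = 1`
  have hρσ : B.rhomin ^ 2 ≤ Real.sin (bandX μ σ) ^ 2 + Real.sin (bandY μ σ) ^ 2 := by
    have h0 := B.rho_ge μ hμ σ
    have hρ0 := B.rhomin_pos
    calc B.rhomin ^ 2 ≤ (Real.sqrt (Real.sin (bandX μ σ) ^ 2 + Real.sin (bandY μ σ) ^ 2)) ^ 2 := by gcongr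
      _ = Real.sin (bandX μ σ) ^ 2 + Real.sin (bandY μ σ) ^ 2 := Real.sq_sqrt (by positivity)
  have hs1 : s = 1 := by
    rcases hs with hs | hs
    · exact hs
    · exfalso
      -- `s·I₀ ≥ ρ² − 2e₃ > 0` but `I₀ ≥ ι > 0` and `s = −1`
      have e : s * (Real.sin Sx * Real.sin (bandX μ σ) + Real.sin Sy * Real.sin (bandY μ σ)) =
          Real.sin (bandX μ σ) ^ 2 + Real.sin (bandY μ σ) ^ 2 +
          ((s * Real.sin Sx - Real.sin (bandX μ σ)) * Real.sin (bandX μ σ) +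
            (s * Real.sin Sy - Real.sin (bandY μ σ)) * Real.sin (bandY μ σ)) := by ring
      have bnd := abs_two_term_le dX (Real.abs_sin_le_one (bandX μ σ)) dY (Real.abs_sin_le_one (bandY μ σ))
      have bnd' := neg_abs_le ((s * Real.sin Sx - Real.sin (bandX μ σ)) * Real.sin (bandX μ σ) +
            (s * Real.sin Sy - Real.sin (bandY μ σ)) * Real.sin (bandY μ σ))
      have hpos : 0 < s * (Real.sin Sx * Real.sin (bandX μ σ) + Real.sin Sy * Real.sin (bandY μ σ)) := by
        rw [e]; rw [he₃] at hρ; linarith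
      rw [hs] at hpos
      linarith
  rw [hs1, one_mul] at dX dY
  -- step 5: `Sx ≡ xσ`, `Sy ≡ yσ (mod 2π)` up to `πe₃`; the integer is `0` by the umklapp margin
  have hhalf' : e₃ < 1 / 2 := by rw [he₃]; exact hhalf
  obtain ⟨m₀, hm₀⟩ := exists_int_near_of_sin_cos_close dX cX hhalf'
  obtain ⟨m₁, hm₁⟩ := exists_int_near_of_sin_cos_close dY cY hhalf'
  have eSx : Sx - bandX μ σ = bandX μ θ₁ + bandX μ σ := by rw [hSx]; unfold SX; ring
  have eSy : Sy - bandY μ σ = bandY μ θ₁ + bandY μ σ := by rw [hSy]; unfold SY; ring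
  rw [eSx] at hm₀; rw [eSy] at hm₁
  have hK1 := abs_bandX_le_umklappRadius h1 h2 θ₁
  have hK2 := abs_bandX_le_umklappRadius h1 h2 σ
  have hK3 := abs_bandY_le_umklappRadius h1 h2 θ₁
  have hK4 := abs_bandY_le_umklappRadius h1 h2 σ
  have hmarg : π * e₃ + 2 * umklappRadius μ < 2 * π := by rw [he₃]; exact hmargin
  have int_zero : ∀ (m : ℤ) (U V : ℝ), |U| ≤ umklappRadius μ → |V| ≤ umklappRadius μ → |U + V - m * (2 * π)| ≤ π * e₃ → m = 0 := by
    intro m U V hU hV hm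
    by_contra hne
    have h1m : (1 : ℝ) ≤ |(m : ℝ)| := by
      rw [← Int.cast_abs]; exact_mod_cast Int.one_le_abs hne
    have hbig : 2 * π ≤ |(m : ℝ) * (2 * π)| := by
      rw [abs_mul, abs_of_pos (by positivity : (0:ℝ) < 2 * π)]
      calc 2 * π = 1 * (2 * π) := by ring
        _ ≤ |(m : ℝ)| * (2 * π) := mul_le_mul_of_nonneg_right h1m (by positivity)
    have htri : |(m : ℝ) * (2 * π)| ≤ |U + V| + |U + V - m * (2 * π)| := by
      have h0 := abs_sub_abs_le_abs_sub ((m : ℝ) * (2 * π)) (U + V)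
      rw [abs_sub_comm] at h0; linarith only [h0]
    have hUV : |U + V| ≤ 2 * umklappRadius μ := (abs_add_le U V).trans (by linarith only [hU, hV])
    linarith only [hbig, htri, hUV, hm, hmarg]
  have hm₀0 := int_zero m₀ _ _ hK1 hK2 hm₀
  have hm₁0 := int_zero m₁ _ _ hK3 hK4 hm₁
  rw [hm₀0] at hm₀; rw [hm₁0] at hm₁
  simp only [Int.cast_zero, zero_mul, sub_zero] at hm₀ hm₁
  -- step 6: `p(σ) ≈ −p(θ₁) = p(θ₁ + π)` and the chord bound
  obtain ⟨px, py, -, -⟩ := band_add_pi h1 h2 θ₁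
  have hch := chord_lower B hμ σ (θ₁ + π)
  rw [px, py, sub_neg_eq_add, sub_neg_eq_add, add_comm (bandX μ σ), add_comm (bandY μ σ)] at hch
  have hsq : (bandX μ θ₁ + bandX μ σ) ^ 2 + (bandY μ θ₁ + bandY μ σ) ^ 2 ≤ 2 * (π * e₃) ^ 2 := by
    have a1 : (bandX μ θ₁ + bandX μ σ) ^ 2 ≤ (π * e₃) ^ 2 := by
      rw [← sq_abs (bandX μ θ₁ + bandX μ σ)]
      exact pow_le_pow_left₀ (abs_nonneg _) hm₀ 2
    have a2 : (bandY μ θ₁ + bandY μ σ) ^ 2 ≤ (π * e₃) ^ 2 := by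
      rw [← sq_abs (bandY μ θ₁ + bandY μ σ)]
      exact pow_le_pow_left₀ (abs_nonneg _) hm₁ 2
    linarith only [a1, a2]
  have hang : (σ - (θ₁ + π)) / 2 = (σ - θ₁ - π) / 2 := by ring
  rw [hang] at hch
  -- `4u² sin² ≤ 2π²e₃²` ⇒ `|sin| ≤ πe₃/(√2 u)`
  have hs2 : Real.sin ((σ - θ₁ - π) / 2) ^ 2 ≤ (π * e₃ / (Real.sqrt 2 * B.umin)) ^ 2 := by
    have h2 : (Real.sqrt 2) ^ 2 = 2 := Real.sq_sqrt (by norm_num)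
    rw [div_pow, mul_pow, mul_pow, h2]
    rw [le_div_iff₀ (by positivity)]
    have hu2 : 0 < B.umin ^ 2 := by positivity
    nlinarith only [hch, hsq, hu2]
  have := Real.sqrt_le_sqrt hs2
  rw [Real.sqrt_sq_eq_abs, Real.sqrt_sq (by positivity)] at this
  rw [he₃] at this ⊢
  exact this

/-- **Alignment dichotomy.**  A near-zero, near-critical diagonal configuration is either aligned or anti-aligned WITH MARGIN:
if `|h(θ₁;σ,σ)| ≤ η₀` and `|sin S_x·x′(σ) + sin S_y·y′(σ)| ≤ η₁` then `ρ_min² − 2e₃ ≤ |sin S_x·sin x(σ) + sin S_y·sin y(σ)|`,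
`e₃ = η₀/Dt_min + s_max·C_g(η₁ + 2 s_max η₀/Dt_min)` (so the sign read by `even_key_signed` / `row_kill_*` / `aligned_rigidity` is available on every
row the two-regime sum treats as near-critical). [cite: BenfattoGiulianiMastropietro2006, App. A2] -/
theorem abs_alignment_ge {θ₁ σ η₀ η₁ : ℝ} (hlo : a ≤ μ - η₀) (hhi : μ + η₀ ≤ b)
    (hH : |hfun μ θ₁ σ σ| ≤ η₀)
    (hH' : |Real.sin (SX μ θ₁ σ σ) * bandVX μ σ + Real.sin (SY μ θ₁ σ σ) * bandVY μ σ| ≤ η₁) :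
    B.rhomin ^ 2 - 2 * (η₀ / B.Dtmin + B.smax * (B.Cg * (η₁ + 2 * B.smax * (η₀ / B.Dtmin)))) ≤
      |Real.sin (SX μ θ₁ σ σ) * Real.sin (bandX μ σ) + Real.sin (SY μ θ₁ σ σ) * Real.sin (bandY μ σ)| := by
  obtain ⟨h1, h2⟩ := B.level hμ
  have hsm := B.smax_pos; have hCg := B.Cg_pos; have hD := B.Dtmin_pos
  set Sx := SX μ θ₁ σ σ with hSx
  set Sy := SY μ θ₁ σ σ with hSy
  set e₃ := η₀ / B.Dtmin + B.smax * (B.Cg * (η₁ + 2 * B.smax * (η₀ / B.Dtmin))) with he₃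
  have hh' : |eps2 Sx Sy - μ| ≤ η₀ := by unfold hfun at hH; exact hH
  obtain ⟨φ, hsx, hsy, -, -⟩ := exists_near_curve_trig B hμ hh' hlo hhi
  have k1 : |Real.sin (bandX μ φ) * bandVX μ σ + Real.sin (bandY μ φ) * bandVY μ σ| ≤ η₁ + 2 * B.smax * (η₀ / B.Dtmin) :=
    (cross_perturb B hμ hsx hsy).trans (by linarith)
  obtain ⟨j, hj⟩ := exists_int_near_of_cross_small B hμ k1
  obtain ⟨s, hs, ax, ay, -, -⟩ := exists_sign_align B hμ hj
  have hsabs : |s| = 1 := by rcases hs with rfl | rfl <;> norm_num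
  have dX : |s * Real.sin Sx - Real.sin (bandX μ σ)| ≤ e₃ := by
    calc |s * Real.sin Sx - Real.sin (bandX μ σ)|
        = |s * (Real.sin Sx - Real.sin (bandX μ φ)) + (s * Real.sin (bandX μ φ) - Real.sin (bandX μ σ))| := by ring_nf
      _ ≤ |s * (Real.sin Sx - Real.sin (bandX μ φ))| + |s * Real.sin (bandX μ φ) - Real.sin (bandX μ σ)| := abs_add_le _ _
      _ ≤ η₀ / B.Dtmin + B.smax * (B.Cg * (η₁ + 2 * B.smax * (η₀ / B.Dtmin))) := by
          rw [abs_mul, hsabs, one_mul]; exact add_le_add hsx ax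
  have dY : |s * Real.sin Sy - Real.sin (bandY μ σ)| ≤ e₃ := by
    calc |s * Real.sin Sy - Real.sin (bandY μ σ)|
        = |s * (Real.sin Sy - Real.sin (bandY μ φ)) + (s * Real.sin (bandY μ φ) - Real.sin (bandY μ σ))| := by ring_nf
      _ ≤ |s * (Real.sin Sy - Real.sin (bandY μ φ))| + |s * Real.sin (bandY μ φ) - Real.sin (bandY μ σ)| := abs_add_le _ _
      _ ≤ η₀ / B.Dtmin + B.smax * (B.Cg * (η₁ + 2 * B.smax * (η₀ / B.Dtmin))) := by
          rw [abs_mul, hsabs, one_mul]; exact add_le_add hsy ay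
  have hρσ : B.rhomin ^ 2 ≤ Real.sin (bandX μ σ) ^ 2 + Real.sin (bandY μ σ) ^ 2 := by
    have h0 := B.rho_ge μ hμ σ
    have hρ0 := B.rhomin_pos
    calc B.rhomin ^ 2 ≤ (Real.sqrt (Real.sin (bandX μ σ) ^ 2 + Real.sin (bandY μ σ) ^ 2)) ^ 2 := by gcongr
      _ = Real.sin (bandX μ σ) ^ 2 + Real.sin (bandY μ σ) ^ 2 := Real.sq_sqrt (by positivity)
  have e : s * (Real.sin Sx * Real.sin (bandX μ σ) + Real.sin Sy * Real.sin (bandY μ σ)) =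
      Real.sin (bandX μ σ) ^ 2 + Real.sin (bandY μ σ) ^ 2 +
      ((s * Real.sin Sx - Real.sin (bandX μ σ)) * Real.sin (bandX μ σ) +
        (s * Real.sin Sy - Real.sin (bandY μ σ)) * Real.sin (bandY μ σ)) := by ring
  have bnd := abs_two_term_le dX (Real.abs_sin_le_one (bandX μ σ)) dY (Real.abs_sin_le_one (bandY μ σ))
  have bnd' := neg_abs_le ((s * Real.sin Sx - Real.sin (bandX μ σ)) * Real.sin (bandX μ σ) +
        (s * Real.sin Sy - Real.sin (bandY μ σ)) * Real.sin (bandY μ σ))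
  have hlow : B.rhomin ^ 2 - 2 * e₃ ≤ s * (Real.sin Sx * Real.sin (bandX μ σ) + Real.sin Sy * Real.sin (bandY μ σ)) := by
    rw [e]; linarith
  have habs : |s * (Real.sin Sx * Real.sin (bandX μ σ) + Real.sin Sy * Real.sin (bandY μ σ))| =
      |Real.sin Sx * Real.sin (bandX μ σ) + Real.sin Sy * Real.sin (bandY μ σ)| := by rw [abs_mul, hsabs, one_mul]
  rw [← habs]
  exact hlow.trans (le_abs_self _)

end Aligned

end Literature.MathematicalPhysics.QuantumLattice.BandSectorCounting

end
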